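import Mathlib.NumberTheory.NumberField.ClassNumber
import Summits.QuantumAdvantage.QuantumAdvantage.Theses.LinnikCubicClassGroups
import Summits.QuantumAdvantage.QuantumAdvantage.Theorems.LinnikCubicClassGroupsPureCubicClassGroupFBQPStubCubicFieldFacts
import Summits.QuantumAdvantage.QuantumAdvantage.Theorems.LinnikCubicClassGroupsPureCubicClassNumberHardStubClassNumberLe
import Summits.QuantumAdvantage.QuantumAdvantage.Theorems.LinnikCubicClassGroupsPureCubicClassNumberHardStubModThreePolyTime
import Literature.Computability.Complexity.RandomizedProofs
import Literature.Computability.Complexity.StackWordArith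
import HarnessLib
import Literature.NumberTheory.NumberFields.PureCubicClassNumberModThree

/-!
# `PureCubicClassNumberHard` from Honda's `3 ∣ h` criterion and worst-case Φ-hiding (`e = 3`)

Crux `stmt-QuantumAdvantage-11826` (route `LinnikCubicClassGroups`, rank-0 hypothesis-type target
`X = PureCubicClassNumberHard`: no PPT algorithm prints, on every input `x` with non-cube
`m = decodeNat x` and every cubic number field `K ∋ ∛m`, the `2|x|+8` low bits of `h_K` with
probability `≥ 2/3`). Line `Sketch` (honda-leak arm; skeleton
`Cruxes/PureCubicClassNumberHard/Lines/Sketch.lean`). `X` itself is an open classical-hardness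
hypothesis (with the route's quantum half it yields `P ≠ PSPACE`); this file proves the line's
TRANSFER, unconditionally:

* `hondaBitDecider_of_classNumberAlgorithm` — **the reduction**: assuming Honda's criterion
  (named fact `Honda1971_three_dvd_classNumber_twoPrimes`, below), a PPT algorithm `A` for the
  class-number bits yields ONE PPT algorithm deciding, for every `N = pq ≡ ±1 (mod 9)` (`p ≠ q`
  primes), the Honda bit `[¬(p ≡ 2,5 ∧ q ≡ 2,5 (mod 9))] = [3 ∣ h(ℚ(∛N))]` from `N` alone: run `A`
  on `encodeNat N` and output `[3 ∣ ⟦A's output⟧]`. Correctness: Honda's criterion, and the window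
  `2|x|+8` returns ALL of `h_K` (`classNumber_lt_window`, from the landed
  `stub_classNumber_le : h_K ≤ 48 m²` and `decodeNat x < 2^{|x|+1}`), so the derived algorithm is
  right whenever `A` prints the correct bits (push-forward monotonicity
  `pr_singleton_le_pr_modThree`); running time: `A`'s TM2 machine composed with the `FP`
  post-processing `stub_modThree_polyTime` (`PolyTimeComputable.comp_holds`). On the two promise
  families of the idea card the Honda bit is the hidden Eisenstein type `[p ≡ 1 (mod 3)]`
  (`eisensteinTypeDecider_of_classNumberAlgorithm`; the card's C1 "`3 ∣ h ↔ p ≡ 1 (mod 3)`" is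
  this residue logic) resp. `[p ≡ q ≡ 8 (mod 9)]` (`eisensteinSplitDecider_of_classNumberAlgorithm`).
* `pureCubicClassNumberHard_of_honda_of_hondaBitHard` — contrapositive with the WEAKEST of the
  three hypotheses: Honda's criterion + "no PPT algorithm decides the Honda bit of every
  `N = pq ≡ ±1 (mod 9)`" imply `X`.
* `pureCubicClassNumberHard_of_honda_of_phiHiding3` — contrapositive: Honda's criterion and the
  WORST-CASE Φ-HIDING HYPOTHESIS for the fixed exponent `e = 3` on that promise family (an explicit
  hypothesis `hΦ` of the theorem, NOT a tree fact and not asserted anywhere: a worst-case,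
  fixed-exponent analogue of the Φ-Hiding Assumption of Cachin–Micali–Stadler 1999, §2.3 — which
  is average-case, with `k`-bit hidden primes —; by their Remark 1 deciding `e ∣ φ(m)` is known to
  be easy only for `e > m^{1/4}`) imply `X`. So, given Honda's theorem, `X` is no stronger than
  worst-case hardness of "`3 ∣ φ(N)`?" for RSA moduli `N ≡ 1 (mod 9)` — the calibration this line
  was triaged for; the conditional summit theorem it yields is dominated by route `Shor` (that
  hypothesis already gives `FACT ∉ BPP`), as the idea card concedes.
* `pureCubicClassNumberHard_of_honda_of_eisensteinSplitHard` — the same with the card's variant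
  hypothesis (hardness of `[p ≡ q ≡ 8 (mod 9)]` for `p ≡ q ≡ 2 (mod 3)`, `pq ≡ 1 (mod 9)`).

## References

* T. Honda, *Pure cubic fields whose class numbers are multiples of three*, J. Number Theory 3
  (1971) 7–12, Theorem (cases (iv), (v)). [Honda1971]
* S. Aouissi, D. C. Mayer, M. C. Ismaili, M. Talbi, A. Azizi, *3-rank of ambiguous class groups of
  cubic Kummer extensions*, Period. Math. Hungar. 81 (2020) 250–274, eq. (2.1) and Thm. 2.3.
  [AouissiMayerIsmailiTalbiAzizi2020]
* C. Cachin, S. Micali, M. Stadler, *Computationally private information retrieval with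
  polylogarithmic communication*, EUROCRYPT '99, LNCS 1592, §2 (Φ-Hiding Assumption).
  [CachinMicaliStadler1999]
-/

namespace Summit.QuantumAdvantage.QuantumAdvantage.Theorems.LinnikCubicClassGroups

open Literature.Computability.Complexity _root_.Computability NumberField

/-! ### The named fact: Honda's criterion, two-prime radicands of Dedekind's second species -/

/-- The binary reading of a word of length `n` is below `2^{n+1}` (Mathlib's `decodePosNum` reads an
implicit leading `1` at the end of the word). [folklore] -/
theorem decodePosNum_lt : ∀ l : List Bool, ((decodePosNum l : PosNum) : ℕ) < 2 ^ (l.length + 1)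
  | [] => by simp [decodePosNum]
  | false :: l => by
    have ih := decodePosNum_lt l
    simp only [decodePosNum, PosNum.cast_bit0, List.length_cons, pow_succ] at ih ⊢
    omega
  | true :: l => by
    have ih := decodePosNum_lt l
    by_cases hl : l = []
    · subst hl; simp [decodePosNum]
    · simp only [decodePosNum, if_neg hl, PosNum.cast_bit1, List.length_cons, pow_succ] at ih ⊢
      omega

/-- `decodeNat x < 2^{|x|+1}`. [folklore] -/
theorem decodeNat_lt_two_pow (x : List Bool) : decodeNat x < 2 ^ (x.length + 1) := by
  unfold decodeNat decodeNum
  split_ifs with h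
  · simp
  · have := decodePosNum_lt x
    simpa using this

/-- THE WINDOW: for an admissible pair `(x, K)` of the crux, the class number has fewer than
`2|x|+8` bits (`h_K ≤ 48 m² < 48 · 4^{|x|+1} = 192 · 4^{|x|} < 2^{2|x|+8}`, by the landed
`stub_classNumber_le`). [folklore] -/
theorem classNumber_lt_window (x : List Bool) (K : Type) [Field K] [NumberField K]
    (h3 : Module.finrank ℚ K = 3) (hm : ∀ r : ℕ, r ^ 3 ≠ decodeNat x)
    (hα : ∃ α : K, α ^ 3 = (decodeNat x : K)) :
    classNumber K < 2 ^ (2 * x.length + 8) := by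
  have h1 := stub_classNumber_le K h3 (decodeNat x) hm hα
  have h2 := decodeNat_lt_two_pow x
  have h3' : (decodeNat x) ^ 2 < (2 ^ (x.length + 1)) ^ 2 :=
    Nat.pow_lt_pow_left h2 two_ne_zero
  have h4 : (2 ^ (x.length + 1)) ^ 2 = 4 * 4 ^ x.length := by
    rw [← pow_mul, Nat.mul_comm (x.length + 1) 2, pow_mul]; norm_num [pow_succ]; ring
  have h5 : 2 ^ (2 * x.length + 8) = 256 * 4 ^ x.length := by
    rw [pow_add, pow_mul]; norm_num; ring
  rw [h5]
  rw [h4] at h3'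
  omega

/-- Reading back the window: `⟦ofFn (i ↦ testBit h i)⟧ = h` when `h < 2^L`. [folklore] -/
theorem bitsToNat_ofFn_testBit {h L : ℕ} (hlt : h < 2 ^ L) :
    bitsToNat (List.ofFn fun i : Fin L => h.testBit i.val) = h := by
  apply Nat.eq_of_testBit_eq
  intro i
  rw [Com.testBit_bitsToNat, List.getD_eq_getElem?_getD, List.getElem?_ofFn]
  by_cases hi : i < L
  · simp [hi]
  · simp only [hi, ↓reduceDIte, Option.getD_none]
    symm
    apply Nat.testBit_eq_false_of_lt
    exact lt_of_lt_of_le hlt (Nat.pow_le_pow_right two_pos (not_lt.mp hi))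

/-! ### The derived one-bit algorithm `(x, r) ↦ [3 ∣ ⟦A(x, r)⟧]` and its analysis -/

/-- The derived algorithm `⟨(x, r) ↦ [⟦A.run x r⟧ ≡ 0 (mod 3)], A.coinLen⟩` is PPT when `A` is:
`A`'s machine composed with the `FP` post-processing (`stub_modThree_polyTime`,
`PolyTimeComputable.comp_holds`). [folklore] -/
theorem isPolyTime_modThree {A : RandAlg (List Bool) (List Bool)} (hA : A.IsPolyTime id id) :
    ({ run := fun x r => decide (bitsToNat (A.run x r) % 3 = 0), coinLen := A.coinLen } :
      RandAlg (List Bool) Bool).IsPolyTime id encodeBool :=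
  ⟨PolyTimeComputable.comp_holds stub_modThree_polyTime hA.1, hA.2⟩

/-- Output law of the derived algorithm = push-forward of `A`'s output law. [folklore] -/
theorem outputPMF_modThree (A : RandAlg (List Bool) (List Bool)) (x : List Bool) :
    ({ run := fun x r => decide (bitsToNat (A.run x r) % 3 = 0), coinLen := A.coinLen } :
      RandAlg (List Bool) Bool).outputPMF id x =
      (A.outputPMF id x).map (fun l : List Bool => decide (bitsToNat l % 3 = 0)) := by
  simp only [RandAlg.outputPMF, PMF.map_comp]
  rfl

/-- Push-forward monotonicity: if `A` prints `v` then the derived algorithm prints `[3 ∣ ⟦v⟧]`, so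
`Pr[A = v] ≤ Pr[derived = [3 ∣ ⟦v⟧]]`. [folklore] -/
theorem pr_singleton_le_pr_modThree (A : RandAlg (List Bool) (List Bool)) (x v : List Bool)
    (b : Bool) (hv : decide (bitsToNat v % 3 = 0) = b) :
    A.pr id x {v} ≤
      ({ run := fun x r => decide (bitsToNat (A.run x r) % 3 = 0), coinLen := A.coinLen } :
        RandAlg (List Bool) Bool).pr id x {b' | b' = b} := by
  unfold RandAlg.pr
  rw [outputPMF_modThree, PMF.toOuterMeasure_map_apply]
  have hle1 : (A.outputPMF id x).toOuterMeasure
      ((fun l : List Bool => decide (bitsToNat l % 3 = 0)) ⁻¹' {b' | b' = b}) ≤ 1 :=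
    calc (A.outputPMF id x).toOuterMeasure
          ((fun l : List Bool => decide (bitsToNat l % 3 = 0)) ⁻¹' {b' | b' = b})
        ≤ (A.outputPMF id x).toOuterMeasure Set.univ :=
          (A.outputPMF id x).toOuterMeasure.mono (Set.subset_univ _)
      _ = 1 := (PMF.toOuterMeasure_apply_eq_one_iff _ _).2 (Set.subset_univ _)
  refine ENNReal.toReal_mono (ne_top_of_le_ne_top ENNReal.one_ne_top hle1) ?_
  refine (A.outputPMF id x).toOuterMeasure.mono ?_
  intro w hw
  rw [Set.mem_singleton_iff] at hw
  subst hw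
  simpa using hv

/-- A product of two distinct primes is not a cube. [folklore] -/
theorem not_cube_mul_prime {p q : ℕ} (hp : p.Prime) (hq : q.Prime) (hpq : p ≠ q) (r : ℕ) :
    r ^ 3 ≠ p * q := by
  intro h
  have hpr : p ∣ r := hp.dvd_of_dvd_pow (by rw [h]; exact dvd_mul_right p q)
  obtain ⟨s, rfl⟩ := hpr
  have h' : p * (p ^ 2 * s ^ 3) = p * q := by rw [← h]; ring
  have h'' : p ^ 2 * s ^ 3 = q := Nat.eq_of_mul_eq_mul_left hp.pos h'
  have hpq' : p ∣ q := ⟨p * s ^ 3, by rw [← h'']; ring⟩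
  exact hpq ((Nat.prime_dvd_prime_iff_eq hp hq).mp hpq')

/-! ### The reduction: a class-number algorithm decides the Honda bit of `N = pq ≡ ±1 (mod 9)` -/

/-- **THE REDUCTION, general form.** Assuming Honda's criterion: a PPT algorithm printing the
class-number bits on every admissible input (the `∃`-body negated by the crux, verbatim) yields ONE
PPT algorithm which, for all distinct primes `p, q` with `N = pq ≡ ±1 (mod 9)`, decides with
probability `≥ 2/3` the HONDA BIT of `N` — "not both `p` and `q` are `≡ 2, 5 (mod 9)`", i.e.
`3 ∣ h(ℚ(∛N))` — from `N` alone: run `A` on `encodeNat N` (admissible: `N` is not a cube, `ℚ(∛N)`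
exists by `factsExists`) and output `[3 ∣ ⟦output⟧]`; correct whenever `A` is (Honda + the window),
PPT by composition. [folklore] -/
theorem hondaBitDecider_of_classNumberAlgorithm
    (hH : Literature.NumberTheory.NumberFields.Honda1971_three_dvd_classNumber_twoPrimes)
    (hA : ∃ A : RandAlg (List Bool) (List Bool), A.IsPolyTime id id ∧
      ∀ (x : List Bool) (K : Type) [Field K] [NumberField K], Module.finrank ℚ K = 3 →
        (∀ r : ℕ, r ^ 3 ≠ decodeNat x) → (∃ α : K, α ^ 3 = (decodeNat x : K)) →
          (2 : ℝ) / 3 ≤ A.pr id x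
            {List.ofFn (fun i : Fin (2 * x.length + 8) => (classNumber K).testBit i.val)}) :
    ∃ D : RandAlg (List Bool) Bool, D.IsPolyTime id encodeBool ∧
      ∀ p q : ℕ, p.Prime → q.Prime → p ≠ q → ((p * q) % 9 = 1 ∨ (p * q) % 9 = 8) →
        (2 : ℝ) / 3 ≤ D.pr id (encodeNat (p * q))
          {b | b = decide (¬ ((p % 9 = 2 ∨ p % 9 = 5) ∧ (q % 9 = 2 ∨ q % 9 = 5)))} := by
  obtain ⟨A, hApt, hAcorr⟩ := hA
  refine ⟨{ run := fun x r => decide (bitsToNat (A.run x r) % 3 = 0), coinLen := A.coinLen },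
    isPolyTime_modThree hApt, ?_⟩
  intro p q hp hq hpq h9
  have hm : decodeNat (encodeNat (p * q)) = p * q := decode_encodeNat _
  have hnc : ∀ r : ℕ, r ^ 3 ≠ decodeNat (encodeNat (p * q)) := by
    rw [hm]; exact not_cube_mul_prime hp hq hpq
  obtain ⟨K, _, _, h3, hα⟩ := factsExists (p * q) (not_cube_mul_prime hp hq hpq)
  have hα' : ∃ α : K, α ^ 3 = (decodeNat (encodeNat (p * q)) : K) := by rw [hm]; exact hα
  have hAK := hAcorr (encodeNat (p * q)) K h3 hnc hα'
  have hh : 3 ∣ classNumber K ↔ ¬ ((p % 9 = 2 ∨ p % 9 = 5) ∧ (q % 9 = 2 ∨ q % 9 = 5)) :=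
    hH p q hp hq hpq h9 K h3 hα
  have hlt : classNumber K < 2 ^ (2 * (encodeNat (p * q)).length + 8) :=
    classNumber_lt_window (encodeNat (p * q)) K h3 hnc hα'
  refine hAK.trans (pr_singleton_le_pr_modThree A _ _ _ ?_)
  rw [bitsToNat_ofFn_testBit hlt]
  refine decide_eq_decide.mpr ⟨fun h0 => hh.mp (by omega), fun h1 => ?_⟩
  have := hh.mpr h1
  omega

/-- **The reduction on the Φ-hiding promise family** (C2 of the idea card): on
`{N = pq ≡ 1 (mod 9) : p ≡ q ≡ 1 (mod 3) or {p, q} ≡ {2, 5} (mod 9)}` the Honda bit IS the hidden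
Eisenstein type `[p ≡ 1 (mod 3)]` (equivalently `[3 ∣ φ(N)]`), so the same derived algorithm decides
it — the `∃`-body negated by the Φ-hiding hypothesis of `pureCubicClassNumberHard_of_honda_of_phiHiding3`,
verbatim. [folklore] -/
theorem eisensteinTypeDecider_of_classNumberAlgorithm
    (hH : Literature.NumberTheory.NumberFields.Honda1971_three_dvd_classNumber_twoPrimes)
    (hA : ∃ A : RandAlg (List Bool) (List Bool), A.IsPolyTime id id ∧
      ∀ (x : List Bool) (K : Type) [Field K] [NumberField K], Module.finrank ℚ K = 3 →
        (∀ r : ℕ, r ^ 3 ≠ decodeNat x) → (∃ α : K, α ^ 3 = (decodeNat x : K)) →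
          (2 : ℝ) / 3 ≤ A.pr id x
            {List.ofFn (fun i : Fin (2 * x.length + 8) => (classNumber K).testBit i.val)}) :
    ∃ D : RandAlg (List Bool) Bool, D.IsPolyTime id encodeBool ∧
      ∀ p q : ℕ, p.Prime → q.Prime → p ≠ q → (p * q) % 9 = 1 →
        ((p % 3 = 1 ∧ q % 3 = 1) ∨ (p % 9 = 2 ∧ q % 9 = 5) ∨ (p % 9 = 5 ∧ q % 9 = 2)) →
        (2 : ℝ) / 3 ≤ D.pr id (encodeNat (p * q)) {b | b = decide (p % 3 = 1)} := by
  obtain ⟨D, hD, hcorr⟩ := hondaBitDecider_of_classNumberAlgorithm hH hA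
  refine ⟨D, hD, fun p q hp hq hpq h9 htype => ?_⟩
  have key : decide (¬ ((p % 9 = 2 ∨ p % 9 = 5) ∧ (q % 9 = 2 ∨ q % 9 = 5))) =
      decide (p % 3 = 1) :=
    decide_eq_decide.mpr (by rcases htype with ⟨hp1, -⟩ | ⟨hp2, hq5⟩ | ⟨hp5, hq2⟩ <;> omega)
  have h := hcorr p q hp hq hpq (Or.inl h9)
  rwa [key] at h

/-- **The reduction on the inert promise family** (the card's variant `EisensteinSplitHard`): for
`p ≡ q ≡ 2 (mod 3)` with `pq ≡ 1 (mod 9)` (so `{p, q} (mod 9) ∈ {{2,5}, {8,8}}`) the Honda bit IS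
`[p ≡ q ≡ 8 (mod 9)]`, i.e. whether `ζ₃` is a cube modulo both prime factors (`9 ∣ p² − 1`), so the
same derived algorithm decides it. [folklore] -/
theorem eisensteinSplitDecider_of_classNumberAlgorithm
    (hH : Literature.NumberTheory.NumberFields.Honda1971_three_dvd_classNumber_twoPrimes)
    (hA : ∃ A : RandAlg (List Bool) (List Bool), A.IsPolyTime id id ∧
      ∀ (x : List Bool) (K : Type) [Field K] [NumberField K], Module.finrank ℚ K = 3 →
        (∀ r : ℕ, r ^ 3 ≠ decodeNat x) → (∃ α : K, α ^ 3 = (decodeNat x : K)) →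
          (2 : ℝ) / 3 ≤ A.pr id x
            {List.ofFn (fun i : Fin (2 * x.length + 8) => (classNumber K).testBit i.val)}) :
    ∃ D : RandAlg (List Bool) Bool, D.IsPolyTime id encodeBool ∧
      ∀ p q : ℕ, p.Prime → q.Prime → p ≠ q → p % 3 = 2 → q % 3 = 2 → (p * q) % 9 = 1 →
        (2 : ℝ) / 3 ≤ D.pr id (encodeNat (p * q)) {b | b = decide (p % 9 = 8 ∧ q % 9 = 8)} := by
  obtain ⟨D, hD, hcorr⟩ := hondaBitDecider_of_classNumberAlgorithm hH hA
  refine ⟨D, hD, fun p q hp hq hpq hp2 hq2 h9 => ?_⟩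
  have h9' : (p % 9) * (q % 9) % 9 = 1 := by rw [← Nat.mul_mod, h9]
  have key : decide (¬ ((p % 9 = 2 ∨ p % 9 = 5) ∧ (q % 9 = 2 ∨ q % 9 = 5))) =
      decide (p % 9 = 8 ∧ q % 9 = 8) := by
    refine decide_eq_decide.mpr ?_
    have hp9 : p % 9 = 2 ∨ p % 9 = 5 ∨ p % 9 = 8 := by omega
    have hq9 : q % 9 = 2 ∨ q % 9 = 5 ∨ q % 9 = 8 := by omega
    rcases hp9 with hp9 | hp9 | hp9 <;> rcases hq9 with hq9 | hq9 | hq9 <;>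
      · rw [hp9, hq9] at h9'; omega
  have h := hcorr p q hp hq hpq (Or.inl h9)
  rwa [key] at h

/-! ### The transfers: the crux from Honda's criterion and one hardness hypothesis -/

/-- **THE TRANSFER, weakest hypothesis (line honda-leak).** Honda's `3 ∣ h` criterion for
`ℚ(∛(pq))` together with the hypothesis "no PPT algorithm decides the Honda bit
`[¬(p ≡ 2,5 ∧ q ≡ 2,5 (mod 9))]` (= `[3 ∣ h(ℚ(∛pq))]`) of every `N = pq ≡ ±1 (mod 9)` with
probability `≥ 2/3`" — an OPEN worst-case hardness hypothesis about RSA moduli (it is implied by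
each of the two promise-family hypotheses below, hence the weakest of the three), taken as an
explicit hypothesis `hB` and NOT asserted — imply the crux `PureCubicClassNumberHard`
(contrapositive of `hondaBitDecider_of_classNumberAlgorithm`). [folklore] -/
theorem pureCubicClassNumberHard_of_honda_of_hondaBitHard
    (hH : Literature.NumberTheory.NumberFields.Honda1971_three_dvd_classNumber_twoPrimes)
    (hB : ¬ ∃ D : RandAlg (List Bool) Bool, D.IsPolyTime id encodeBool ∧
      ∀ p q : ℕ, p.Prime → q.Prime → p ≠ q → ((p * q) % 9 = 1 ∨ (p * q) % 9 = 8) →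
        (2 : ℝ) / 3 ≤ D.pr id (encodeNat (p * q))
          {b | b = decide (¬ ((p % 9 = 2 ∨ p % 9 = 5) ∧ (q % 9 = 2 ∨ q % 9 = 5)))}) :
    Theses.LinnikCubicClassGroups.PureCubicClassNumberHard :=
  fun hA => hB (hondaBitDecider_of_classNumberAlgorithm hH hA)

/-- **THE TRANSFER via worst-case Φ-hiding for `e = 3` (the card's `EisensteinTypeHard`).** Honda's
criterion together with the WORST-CASE Φ-HIDING HYPOTHESIS for the fixed exponent `e = 3` on the
promise family `{N = pq ≡ 1 (mod 9) : p ≡ q ≡ 1 (mod 3) or {p, q} ≡ {2, 5} (mod 9)}` — no PPT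
algorithm decides `p ≡ 1 (mod 3)` (equivalently `3 ∣ φ(N)`) with probability `≥ 2/3` on every
member; an OPEN hardness hypothesis (a worst-case, fixed-exponent `e = 3` analogue of the
average-case Φ-Hiding Assumption of [CachinMicaliStadler1999, §2.3]; no algorithm is known:
deciding `e ∣ φ(m)` is easy only for `e > m^{1/4}`, ibid. Remark 1), taken here as an explicit
hypothesis `hΦ` and NOT asserted — imply the crux `PureCubicClassNumberHard` (contrapositive of
`eisensteinTypeDecider_of_classNumberAlgorithm`). [folklore] -/
theorem pureCubicClassNumberHard_of_honda_of_phiHiding3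
    (hH : Literature.NumberTheory.NumberFields.Honda1971_three_dvd_classNumber_twoPrimes)
    (hΦ : ¬ ∃ D : RandAlg (List Bool) Bool, D.IsPolyTime id encodeBool ∧
      ∀ p q : ℕ, p.Prime → q.Prime → p ≠ q → (p * q) % 9 = 1 →
        ((p % 3 = 1 ∧ q % 3 = 1) ∨ (p % 9 = 2 ∧ q % 9 = 5) ∨ (p % 9 = 5 ∧ q % 9 = 2)) →
        (2 : ℝ) / 3 ≤ D.pr id (encodeNat (p * q)) {b | b = decide (p % 3 = 1)}) :
    Theses.LinnikCubicClassGroups.PureCubicClassNumberHard :=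
  fun hA => hΦ (eisensteinTypeDecider_of_classNumberAlgorithm hH hA)

/-- **THE TRANSFER via cubic residuosity of `ζ₃` (the card's `EisensteinSplitHard`).** Honda's
criterion together with the hypothesis "no PPT algorithm decides, for all distinct primes
`p ≡ q ≡ 2 (mod 3)` with `pq ≡ 1 (mod 9)`, whether `p ≡ q ≡ 8 (mod 9)` (i.e. whether `ζ₃` is a cube
in `(ℤ[ζ₃]/N)ˣ`) with probability `≥ 2/3`" — an OPEN worst-case hardness hypothesis, explicit as
`hS` and NOT asserted — imply the crux `PureCubicClassNumberHard`. [folklore] -/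
theorem pureCubicClassNumberHard_of_honda_of_eisensteinSplitHard
    (hH : Literature.NumberTheory.NumberFields.Honda1971_three_dvd_classNumber_twoPrimes)
    (hS : ¬ ∃ D : RandAlg (List Bool) Bool, D.IsPolyTime id encodeBool ∧
      ∀ p q : ℕ, p.Prime → q.Prime → p ≠ q → p % 3 = 2 → q % 3 = 2 → (p * q) % 9 = 1 →
        (2 : ℝ) / 3 ≤ D.pr id (encodeNat (p * q)) {b | b = decide (p % 9 = 8 ∧ q % 9 = 8)}) :
    Theses.LinnikCubicClassGroups.PureCubicClassNumberHard :=
  fun hA => hS (eisensteinSplitDecider_of_classNumberAlgorithm hH hA)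

/-! ### The registered stub of the line skeleton (`Cruxes/PureCubicClassNumberHard/Lines/Sketch.lean`) -/

/-- **Registered stub `stub_hondaLeakTransfer`** of the line skeleton (crux stmt-QuantumAdvantage-11826,
line `Sketch`, honda-leak arm): Honda's two-prime criterion (first hypothesis, = the body of the
named fact `Honda1971_three_dvd_classNumber_twoPrimes`) and worst-case Φ-hiding for `e = 3` on the
pure-cubic promise family (second hypothesis) imply the crux — by
`pureCubicClassNumberHard_of_honda_of_phiHiding3`. [folklore] -/
theorem stub_hondaLeakTransfer :
    (∀ p q : ℕ, p.Prime → q.Prime → p ≠ q → ((p * q) % 9 = 1 ∨ (p * q) % 9 = 8) →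
      ∀ (K : Type) [Field K] [NumberField K], Module.finrank ℚ K = 3 →
        (∃ α : K, α ^ 3 = ((p * q : ℕ) : K)) →
          (3 ∣ NumberField.classNumber K ↔ ¬ ((p % 9 = 2 ∨ p % 9 = 5) ∧ (q % 9 = 2 ∨ q % 9 = 5)))) →
    (¬ ∃ D : RandAlg (List Bool) Bool, D.IsPolyTime id encodeBool ∧
      ∀ p q : ℕ, p.Prime → q.Prime → p ≠ q → (p * q) % 9 = 1 →
        ((p % 3 = 1 ∧ q % 3 = 1) ∨ (p % 9 = 2 ∧ q % 9 = 5) ∨ (p % 9 = 5 ∧ q % 9 = 2)) →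
        (2 : ℝ) / 3 ≤ D.pr id (encodeNat (p * q)) {b | b = decide (p % 3 = 1)}) →
    Summit.QuantumAdvantage.QuantumAdvantage.Theses.LinnikCubicClassGroups.PureCubicClassNumberHard :=
  fun hH hΦ => pureCubicClassNumberHard_of_honda_of_phiHiding3 hH hΦ

end Summit.QuantumAdvantage.QuantumAdvantage.Theorems.LinnikCubicClassGroups
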